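import Literature.Probability.RandomPlanarGeometry.LoewnerThrPieces
import Literature.Probability.RandomPlanarGeometry.LoewnerThrFlowDefs
import HarnessLib

/-!
# The through-swallow image flow and driving function are continuous through the swallow instants

Topic `Probability/RandomPlanarGeometry`; theorems only (crux `stmt-CriticalPhenomena-0698`, stub
`stub_isLocal`, through-swallow image chain of the locality of SLE₆: G. F. Lawler (2005), §6.3
Thm. 6.13 — continuity of `U*_t = Φ_t(U_t)` and of `Φ_t = g*_t ∘ Φ ∘ g_t⁻¹` through the instants
at which the hull swallows whole pieces of `A`; Lawler–Schramm–Werner (2003), §5). For a driving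
function `W` from `0`, a `*`-hull `A` and a horizon `[0, β]` on which the remaining hull
`A_t^rem = remHull W A t` is closed and takes finitely many values (`LoewnerThrPieces`), the
through-swallow driving function `U*_t = thrImageDriver W A t` and the flow
`g̃_t(ζ) = thrImageFlow W A t z` of a point `z ∈ ℍ ∖ A` alive at `β` are continuous on `[0, β]`:
on each piece they are the ALIVE objects of the fixed remaining hull (right-continuity, and
left-continuity at non-jump times), and at a jump `s` — where the previous value `B` is first hit,
`B ∖ K̂_s` being the new value — the constants `L_{B_t}` converge by (W)
`tendsto_starShift_slidHull_hullHitTime` (`LoewnerShiftAtContact`) and the flows by its analogue: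

* `norm_starMap_sub_starShift_sub_le` — `‖E_B(z) − L_B − z‖ ≤ 580 r` on `ℍ ∖ B` when
  `B ∩ ℍ ⊆ B̄(x, r)` (Lawler's (3.12), `IsHydrodynamicMap.norm_sub_self_le`);
* `norm_hmap_sub_hmap_le_of_sdiff_subset` — for nested `*`-hulls `A' ⊆ A` whose difference in `ℍ`
  lies in `B̄(0, r)`, `A'` being `ρ`-far from `0`, `2r < ρ`:
  `‖(E_A(y) − L_A) − (E_{A'}(y) − L_{A'})‖ ≤ 1160 r` on `ℍ ∖ A` (`E_A = E_Q ∘ E_{A'}`,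
  `L_A = L_{A'} + L_Q`, the quotient hull `Q ⊆ B̄(0, 2r)`);
* **`tendsto_imageFlow_hullHitTime`** — at the first contact `T = T_B` of the closed hulls with a
  `*`-hull `B` whose still-alive part `B' = B ∖ K̂_T` is closed,
  `g̃^B_t(ζ) − L_B → g̃^{B'}_T(ζ) − L_{B'}` as `t ↑ T` for `z ∈ ℍ ∖ B` alive at `T`;
* **`continuousOn_thrImageDriver`, `continuousOn_thrImageFlow`** — continuity on `Iic β`.
-/

noncomputable section

open Set Filter Topology Function Complex Metric
open UpperHalfPlane (upperHalfPlaneSet)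
open scoped NNReal

namespace Literature.Probability.RandomPlanarGeometry

namespace Loewner

variable {W : ℝ≥0 → ℝ} {A : Set ℂ}

/-! ### The hydrodynamic map of a small hull moves points little -/

/-- **`‖E_B(z) − L_B − z‖ ≤ 580 r` on `ℍ ∖ B`** when `B ∩ ℍ ⊆ B̄(x, r)`: `g_B = Φ_B − L_B` is
hydrodynamically normalised (`E_B(z) − z → L_B`), so Lawler's (3.12) applies
(`IsHydrodynamicMap.norm_sub_self_le`). [cite: Lawler2005, §3.4 (3.12)] -/
theorem norm_starMap_sub_starShift_sub_le {B : Set ℂ} (hB : IsStarHull B) {x r : ℝ} (hr : 0 < r)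
    (hBr : B ∩ upperHalfPlaneSet ⊆ closedBall (x : ℂ) r) {z : ℂ} (hz : z ∈ upperHalfPlaneSet \ B) :
    ‖starMap B z - starShift B - z‖ ≤ 580 * r := by
  have hΦ := isRestrictionMap_starRMap hB
  set φ : ConformalEquiv (upperHalfPlaneSet \ B) upperHalfPlaneSet :=
    (starRMap B hB).trans (addRealUpperHalfPlane (-(starShift B).re)) with hφ
  have hφapp : ∀ z, φ z = starRMap B hB z - starShift B := fun z ↦ by
    conv_rhs => rw [starShift_eq_ofReal_re hB]
    rw [hφ, ConformalEquiv.trans_apply, addRealUpperHalfPlane_apply, ofReal_neg, ← sub_eq_add_neg]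
  have hH : IsHydrodynamicMap B φ := by
    have h1 := (tendsto_hullExt_sub_self hB.isBoundedHull hΦ).sub_const (hullShift (starRMap B hB))
    rw [sub_self] at h1
    refine (h1.mono_left inf_le_left).congr' ?_
    filter_upwards [mem_inf_of_right (mem_principal_self _)] with z hz
    rw [hφapp, starShift_eq hB, hullExt_of_mem_diff hz]; ring
  have h := hH.norm_sub_self_le hBr hr hz
  rw [hφapp] at h
  rw [starMap_eq hB, hullExt_of_mem_diff hz]
  exact h

/-- **Nested `*`-hulls with a small difference have close hydrodynamic maps**: for `A' ⊆ A` with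
`(A ∖ A') ∩ ℍ ⊆ B̄(0, r)`, `A'` missing `B(0, ρ)`, `2r < ρ`, and `y ∈ ℍ ∖ A`,
`‖(E_A(y) − L_A) − (E_{A'}(y) − L_{A'})‖ ≤ 1160 r`: `E_A = E_Q ∘ E_{A'}` and `L_A = L_{A'} + L_Q`
with the quotient hull `Q = cl Φ_{A'}((A ∖ A') ∩ ℍ) ⊆ B̄(0, 2r)` (`E_{A'}` is `2`-Lipschitz on
`B(0, ρ/2)` and fixes `0`), so the difference is `E_Q(w) − L_Q − w`, `w = Φ_{A'}(y)`.
[cite: LawlerSchrammWerner2003Restriction, §2 p. 8 (Semigroups) with Lawler2005, §3.4 (3.12)] -/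
theorem norm_hmap_sub_hmap_le_of_sdiff_subset {A A' : Set ℂ} (hA : IsStarHull A) (hA' : IsStarHull A')
    (hsub : A' ⊆ A) {ρ r : ℝ} (hr : 0 < r) (hrρ : 2 * r < ρ) (hρ : Disjoint (ball (0 : ℂ) ρ) A')
    (hdiff : ∀ w ∈ A \ A', 0 < w.im → ‖w‖ ≤ r) {y : ℂ} (hy : y ∈ upperHalfPlaneSet \ A) :
    ‖(starMap A y - starShift A) - (starMap A' y - starShift A')‖ ≤ 1160 * r := by
  set Φ := starRMap A' hA' with hΦ
  set Q := quotientHull A A' Φ with hQdef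
  have hQ : IsStarHull Q := isStarHull_quotientHull_starRMap hA hA' hsub
  have hadd : starShift A = starShift A' + starShift Q := starShift_eq_add_starShift_quotientHull hA hA' hsub
  -- `Q ⊆ B̄(0, 2r)`
  have hlip : LipschitzOnWith 2 (hullExt Φ) (ball ((0 : ℝ) : ℂ) (ρ / 2)) :=
    lipschitzOnWith_hullExt hA'.1 (isRestrictionMap_starRMap hA') (by exact_mod_cast hρ)
  have h0ball : ((0 : ℝ) : ℂ) ∈ ball ((0 : ℝ) : ℂ) (ρ / 2) := mem_ball_self (by linarith)
  have hQsub : Q ⊆ closedBall (0 : ℂ) (2 * r) := by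
    have himg : Φ '' ((A \ A') ∩ upperHalfPlaneSet) ⊆ closedBall (0 : ℂ) (2 * r) := by
      rintro _ ⟨w, ⟨hwd, hwH⟩, rfl⟩
      have hwr : ‖w‖ ≤ r := hdiff w hwd hwH
      have hwA' : w ∈ upperHalfPlaneSet \ A' := ⟨hwH, hwd.2⟩
      have hwball : w ∈ ball ((0 : ℝ) : ℂ) (ρ / 2) := by
        rw [mem_ball, Complex.ofReal_zero, dist_zero_right]; linarith
      have h1 := hlip.dist_le_mul w hwball ((0 : ℝ) : ℂ) h0ball
      rw [hullExt_of_mem_diff hwA', Complex.ofReal_zero, hullExt_zero hA' (isRestrictionMap_starRMap hA'),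
        dist_zero_right, dist_zero_right] at h1
      rw [mem_closedBall, dist_zero_right]
      calc ‖(Φ w : ℂ)‖ ≤ 2 * ‖w‖ := by exact_mod_cast h1
        _ ≤ 2 * r := by linarith
    rw [hQdef, quotientHull]
    exact closure_minimal himg isClosed_closedBall
  have hQH : Q ∩ upperHalfPlaneSet ⊆ closedBall ((0 : ℝ) : ℂ) (2 * r) := by
    rw [Complex.ofReal_zero]; exact fun w hw ↦ hQsub hw.1
  -- `E_A(y) = E_Q(Φ y)`, `E_{A'}(y) = Φ y`, `Φ y ∈ ℍ ∖ Q`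
  have hy' : y ∈ upperHalfPlaneSet \ A' := ⟨hy.1, fun h ↦ hy.2 (hsub h)⟩
  have hw : Φ y ∈ upperHalfPlaneSet \ Q := by
    rw [hQdef, hA.diff_quotientHull hsub]; exact ⟨y, hy, rfl⟩
  have hEA : starMap A y = starMap Q (Φ y) := by
    rw [starMap_of_mem_diff hA hy, starMap_of_mem_diff hQ hw, starRMap_eq_starRMap_quotientHull_comp hA hA' hsub hy]
  have hEA' : starMap A' y = Φ y := starMap_of_mem_diff hA' hy'
  have hid : (starMap A y - starShift A) - (starMap A' y - starShift A') =
      starMap Q (Φ y) - starShift Q - Φ y := by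
    rw [hEA, hEA', hadd]; ring
  rw [hid]
  calc ‖starMap Q (Φ y) - starShift Q - Φ y‖ ≤ 580 * (2 * r) :=
        norm_starMap_sub_starShift_sub_le hQ (by linarith) hQH hw
    _ = 1160 * r := by ring

/-! ### The image flow is continuous across the first contact with a clopen-contacted hull -/

/-- **The image flow is continuous across the first contact of the closed hulls with `B`, when the
part still alive at the contact time is a clopen piece.** Let `T = T_B` be the (finite) hull hitting
time of the `*`-hull `B` and assume `B' = B ∖ K̂_T` is closed (a `*`-hull or `∅`; every point of
`B ∩ K̂_T` is swallowed exactly at `T`, so `g_t(B ∩ K̂_T) − W_t ⊆ B̄(0, osc_{[t,T]} W + 4√(T − t))`).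
Then for `z ∈ ℍ ∖ B` alive at `T`, `g̃^B_t(ζ) − L_B = E_{B_t}(g_t z − W_t) − L_{B_t} + W_t` tends, as
`t ↑ T`, to `g̃^{B'}_T(ζ) − L_{B'}` (`norm_hmap_sub_hmap_le_of_sdiff_subset` for `B'_t ⊆ B_t` and the
continuity of the alive flow of `B'` at `T`).
[cite: Lawler2005, §6.3 Thm. 6.13 (continuity of Φ_t through the swallowing); LawlerSchrammWerner2003Restriction, §5] -/
theorem tendsto_imageFlow_hullHitTime (hW : Continuous W) {B : Set ℂ} (hB : IsStarHull B)
    {T : ℝ≥0} (hT : hullHitTime W B = T) (hcl : IsClosed (B \ closedHull W T))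
    {z : ℂ} (hzH : 0 < z.im) (hzB : z ∉ B) (hzT : (T : WithTop ℝ≥0) < swallowingTime W z) :
    Tendsto (fun t : ℝ≥0 ↦ imageFlow W B t z - starShift B) (𝓝[<] T)
      (𝓝 (imageFlow W (B \ closedHull W T) T z - starShift (B \ closedHull W T))) := by
  set B' := B \ closedHull W T with hB'def
  have hcl' : IsClosed (B \ B') := by
    have : B \ B' = B ∩ closedHull W T := by
      rw [hB'def, Set.sdiff_sdiff_right_self]
    rw [this]; exact hB.1.isClosed.inter (isClosed_closedHull hW T)
  have hB'sub : B' ⊆ B := sdiff_subset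
  have hdisjT : Disjoint (closedHull W T) B' := Set.disjoint_left.2 fun z hz hzB' ↦ hzB'.2 hz
  have hB' : IsStarHull B' := hB.isStarHull_piece hB'sub hcl hcl'
  have hzB' : z ∉ B' := fun h ↦ hzB (hB'sub h)
  have hBH : B ⊆ {z : ℂ | 0 ≤ z.im} := fun z hz ↦ hB.isBoundedHull.im_nonneg hz
  -- alive before `T`; contacted points are swallowed at `T` exactly
  have halive : ∀ t : ℝ≥0, t < T → Disjoint (closedHull W t) B := fun t ht ↦
    disjoint_closedHull_of_lt_hullHitTime (by rw [hT]; exact WithTop.coe_lt_coe.2 ht)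
  have hswT : ∀ z ∈ B, z ∉ B' → swallowingTime W z = T := fun z hzB hzB' ↦ by
    have hzK : z ∈ closedHull W T := by
      by_contra h; exact hzB' ⟨hzB, h⟩
    exact swallowingTime_eq_of_mem_inter_closedHull hT hzB hzK
  have hlt : ∀ z ∈ B, ∀ t : ℝ≥0, t < T → (t : WithTop ℝ≥0) < swallowingTime W z := fun z hzB t ht ↦ by
    by_contra h
    exact Set.disjoint_left.1 (halive t ht) ⟨hBH hzB, not_lt.1 h⟩ hzB
  have hzlt : ∀ t : ℝ≥0, t < T → (t : WithTop ℝ≥0) < swallowingTime W z := fun t ht ↦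
    lt_trans (WithTop.coe_lt_coe.2 ht) hzT
  -- the difference `B_t ∖ B'_t` in `ℍ` consists of images of contacted points of `B ∩ ℍ`
  have hdiff : ∀ t : ℝ≥0, t < T → ∀ {S : ℝ}, (∀ s : ℝ≥0, s ≤ T - t → |W (t + s) - W t| ≤ S) →
      ∀ w ∈ slidHull W B t \ slidHull W B' t, 0 < w.im →
        ‖w‖ ≤ S + 4 * Real.sqrt ((T - t : ℝ≥0) : ℝ) := by
    intro t ht S hS w hw hwim
    obtain ⟨⟨z, hzB, rfl⟩, hw'⟩ := hw
    have hzB' : z ∉ B' := fun h ↦ hw' ⟨z, h, rfl⟩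
    have hzt := hlt z hzB t ht
    have hzH : 0 < z.im := by
      rcases (show (0 : ℝ) ≤ z.im from hBH hzB).lt_or_eq with h | h
      · exact h
      · exfalso
        have hzre : z = ((z.re : ℝ) : ℂ) := Complex.ext (by simp) (by simp [← h])
        have him0 : (map W t z - W t).im = 0 := by
          rw [Complex.sub_im, Complex.ofReal_im, sub_zero, hzre]
          exact map_ofReal_im hW (by rw [← hzre]; exact hzt)
        exact hwim.ne' him0
    exact norm_map_sub_driving_le_of_swallowed_at hW ht.le hS hzH (hswT z hzB hzB') hzt
  -- uniform continuity of `W` on `[0, T + 1]`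
  have hUC : ∀ {ε₁ : ℝ}, 0 < ε₁ → ∃ η : ℝ, 0 < η ∧ η ≤ 1 ∧ ∀ t : ℝ≥0, t < T → (T : ℝ) - t < η →
      ∀ s : ℝ≥0, s ≤ T - t → |W (t + s) - W t| ≤ ε₁ := by
    intro ε₁ hε₁
    obtain ⟨η, hη, hmod⟩ := exists_forall_abs_sub_driving_le hW ((T : ℝ) + 1) hε₁
    refine ⟨min η 1, lt_min hη one_pos, min_le_right _ _, fun t ht htT s hs ↦ ?_⟩
    have hs' : (s : ℝ) ≤ (T : ℝ) - t := by
      have := NNReal.coe_le_coe.2 hs; rwa [NNReal.coe_sub ht.le] at this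
    have h1 := hmod ((t : ℝ) + s) ⟨by positivity, by linarith⟩ t ⟨t.coe_nonneg, by
      have := NNReal.coe_le_coe.2 ht.le; linarith⟩ (by
      rw [show (t : ℝ) + s - t = s by ring, abs_of_nonneg s.coe_nonneg]
      linarith [min_le_left η 1])
    have hts : ((t : ℝ) + s).toNNReal = t + s := by
      rw [show ((t : ℝ) + s) = ((t + s : ℝ≥0) : ℝ) by push_cast; ring, Real.toNNReal_coe]
    rwa [hts, Real.toNNReal_coe] at h1
  -- a ball around `0` free of `B'_t` for `t ≤ T` near `T`
  obtain ⟨ρ, hρpos, η₀, hη₀, hball⟩ : ∃ ρ : ℝ, 0 < ρ ∧ ∃ η₀ : ℝ, 0 < η₀ ∧ ∀ t : ℝ≥0, t ≤ T →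
      dist t T < η₀ → Disjoint (ball (0 : ℂ) ρ) (slidHull W B' t) := by
    rcases B'.eq_empty_or_nonempty with hB'e | hB'ne
    · refine ⟨1, one_pos, 1, one_pos, fun t _ _ ↦ ?_⟩
      rw [hB'e, slidHull_empty]; exact Set.disjoint_empty _
    · have hTlt : (T : WithTop ℝ≥0) < hullHitTime W B' := lt_hullHitTime_of_disjoint hW hB' hB'ne hdisjT
      have haliveSet : Iic T ⊆ {t : ℝ≥0 | (t : WithTop ℝ≥0) < hullHitTime W B'} := fun t ht ↦
        lt_of_le_of_lt (WithTop.coe_le_coe.2 ht) hTlt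
      set d₀ : ℝ := infDist (0 : ℂ) (slidHull W B' T) with hd₀
      have hBT : IsStarHull (slidHull W B' T) := isStarHull_slidHull_of_disjoint hW hB' hdisjT
      have hd₀pos : 0 < d₀ := by
        rw [hd₀, ← hBT.1.isClosed.notMem_iff_infDist_pos (hB'ne.image _)]
        exact hBT.2
      have hcontDist : ContinuousWithinAt (fun t : ℝ≥0 ↦ infDist (0 : ℂ) (slidHull W B' t)) (Iic T) T :=
        ((continuousOn_infDist_slidHull hW hB' hB'ne) T (haliveSet self_mem_Iic)).mono haliveSet
      obtain ⟨η₀, hη₀, hdist⟩ := Metric.continuousWithinAt_iff.1 hcontDist (d₀ / 2) (by positivity)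
      refine ⟨d₀ / 2, by positivity, η₀, hη₀, fun t htT htd ↦ ?_⟩
      have h1 : dist (infDist (0 : ℂ) (slidHull W B' t)) d₀ < d₀ / 2 := hdist htT htd
      rw [Real.dist_eq, abs_lt] at h1
      refine Set.disjoint_left.2 fun y hy hyB ↦ ?_
      have h2 : infDist (0 : ℂ) (slidHull W B' t) ≤ dist 0 y := infDist_le_dist_of_mem hyB
      rw [mem_ball, dist_comm] at hy
      linarith
  -- continuity of the alive flow of `B'` at `T` from the left
  have hcontF : Tendsto (fun t : ℝ≥0 ↦ imageFlow W B' t z - starShift B') (𝓝[<] T)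
      (𝓝 (imageFlow W B' T z - starShift B')) := by
    have h1 : ContinuousWithinAt (fun v : ℝ≥0 ↦ imageFlow W B' v z) (Iio T) T :=
      (continuousWithinAt_imageFlow' hW hB' hdisjT hzH hzB' hzT).mono fun t ht ↦
        (halive t ht).mono_right hB'sub
    exact h1.tendsto.sub_const _
  rw [Metric.tendsto_nhdsWithin_nhds]
  intro ε hε
  obtain ⟨η₃, hη₃, hL⟩ := Metric.tendsto_nhdsWithin_nhds.1 hcontF (ε / 2) (by positivity)
  -- the modulus of continuity scale
  set ε₁ : ℝ := min (ρ / 8) (ε / (4 * 1160)) with hε₁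
  have hε₁pos : 0 < ε₁ := lt_min (by positivity) (by positivity)
  obtain ⟨η₁, hη₁, -, hmod⟩ := hUC hε₁pos
  set η₂ : ℝ := (ε₁ / 4) ^ 2 with hη₂
  have hη₂pos : 0 < η₂ := by positivity
  refine ⟨min (min η₀ η₃) (min η₁ η₂), lt_min (lt_min hη₀ hη₃) (lt_min hη₁ hη₂pos), fun t ht htd ↦ ?_⟩
  have htT : t < T := ht
  have hdistT : dist t T = (T : ℝ) - t := by
    rw [NNReal.dist_eq, abs_sub_comm, abs_of_nonneg (by have := NNReal.coe_le_coe.2 htT.le; linarith)]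
  have hd0 : dist t T < η₀ := lt_of_lt_of_le htd ((min_le_left _ _).trans (min_le_left _ _))
  have hd3 : dist t T < η₃ := lt_of_lt_of_le htd ((min_le_left _ _).trans (min_le_right _ _))
  have hd1 : (T : ℝ) - t < η₁ := by
    rw [← hdistT]; exact lt_of_lt_of_le htd ((min_le_right _ _).trans (min_le_left _ _))
  have hd2 : (T : ℝ) - t < η₂ := by
    rw [← hdistT]; exact lt_of_lt_of_le htd ((min_le_right _ _).trans (min_le_right _ _))
  -- the radius `r = ε₁ + 4√(T - t) ≤ 2 ε₁`
  set r : ℝ := ε₁ + 4 * Real.sqrt ((T - t : ℝ≥0) : ℝ) with hrdef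
  have hsqrt : Real.sqrt ((T - t : ℝ≥0) : ℝ) ≤ ε₁ / 4 := by
    rw [NNReal.coe_sub htT.le]
    calc Real.sqrt ((T : ℝ) - t) ≤ Real.sqrt η₂ := Real.sqrt_le_sqrt hd2.le
      _ = ε₁ / 4 := by rw [hη₂, Real.sqrt_sq (by positivity)]
  have hrpos : 0 < r := by rw [hrdef]; positivity
  have hr2 : r ≤ 2 * ε₁ := by rw [hrdef]; linarith
  have hrρ : 2 * r < ρ := by
    have : ε₁ ≤ ρ / 8 := min_le_left _ _
    linarith
  -- the two-hull estimate at time `t`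
  have hBt : IsStarHull (slidHull W B t) := isStarHull_slidHull_of_disjoint hW hB (halive t htT)
  have hB't : IsStarHull (slidHull W B' t) :=
    isStarHull_slidHull_of_disjoint hW hB' ((halive t htT).mono_right hB'sub)
  have hsubt : slidHull W B' t ⊆ slidHull W B t := image_mono hB'sub
  have hy : map W t z - W t ∈ upperHalfPlaneSet \ slidHull W B t :=
    map_sub_driving_mem_diff_slidHull hW hB (halive t htT) hzH hzB (hzlt t htT)
  have hest := norm_hmap_sub_hmap_le_of_sdiff_subset hBt hB't hsubt hrpos hrρ (hball t htT.le hd0)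
    (fun w hw hwim ↦ hdiff t htT (hmod t htT hd1) w hw hwim) hy
  have hL' : dist (imageFlow W B' t z - starShift B') (imageFlow W B' T z - starShift B') < ε / 2 :=
    hL htT hd3
  rw [dist_eq_norm] at hL' ⊢
  have hε₁le : ε₁ ≤ ε / (4 * 1160) := min_le_right _ _
  have h1160 : 1160 * r ≤ ε / 2 := by
    calc 1160 * r ≤ 1160 * (2 * (ε / (4 * 1160))) := by
          gcongr
          exact hr2.trans (by linarith)
      _ = ε / 2 := by ring
  have hid : imageFlow W B t z - starShift B - (imageFlow W B' t z - starShift B') =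
      (starMap (slidHull W B t) (map W t z - W t) - starShift (slidHull W B t)) -
        (starMap (slidHull W B' t) (map W t z - W t) - starShift (slidHull W B' t)) := by
    simp only [imageFlow]; ring
  calc ‖imageFlow W B t z - starShift B - (imageFlow W B' T z - starShift B')‖
      ≤ ‖imageFlow W B t z - starShift B - (imageFlow W B' t z - starShift B')‖ +
          ‖imageFlow W B' t z - starShift B' - (imageFlow W B' T z - starShift B')‖ :=
        norm_sub_le_norm_sub_add_norm_sub _ _ _
    _ ≤ ε / 2 + ‖imageFlow W B' t z - starShift B' - (imageFlow W B' T z - starShift B')‖ := by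
        rw [hid]; gcongr; exact hest.trans h1160
    _ < ε / 2 + ε / 2 := by gcongr
    _ = ε := by ring

/-! ### Continuity of the through-swallow driving function and flow on `[0, β]` -/

omit A in
/-- Continuity on `Iic β` from left-continuity at positive times and right-continuity before `β`.
[folklore] -/
theorem continuousOn_Iic_of_left_right {X : Type*} [TopologicalSpace X] {f : ℝ≥0 → X} {β : ℝ≥0}
    (hl : ∀ s : ℝ≥0, 0 < s → s ≤ β → ContinuousWithinAt f (Iio s) s)
    (hr : ∀ s : ℝ≥0, s < β → ContinuousWithinAt f (Ici s) s) : ContinuousOn f (Iic β) := by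
  intro s hs
  have hleft : ContinuousWithinAt f (Iio s) s := by
    rcases (zero_le : (0 : ℝ≥0) ≤ s).eq_or_lt with h | h
    · have : Iio s = ∅ := by rw [← h]; ext x; simp
      rw [ContinuousWithinAt, this, nhdsWithin_empty]; exact tendsto_bot
    · exact hl s h hs
  rcases (show s ≤ β from hs).eq_or_lt with h | h
  · rw [h] at hleft ⊢
    exact continuousWithinAt_Iio_iff_Iic.1 hleft
  · have := hleft.union (hr s h)
    rw [Iio_union_Ici] at this
    exact this.mono (subset_univ _)

section Continuity

variable (hW : Continuous W) (hW0 : W 0 = 0) (hA : IsStarHull A) {β : ℝ≥0}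
  (hcl : ∀ t ≤ β, IsClosed (remHull W A t)) (hfin : (remHull W A '' Icc 0 β).Finite)
include hW hA hcl hfin

/-- **Right-continuity of `U*` before `β`**: on a right piece `[s, s']` of constancy `U*` is the alive
image driving function of the fixed remaining hull plus a constant. [cite: Lawler2005, §6.3 Thm. 6.13] -/
theorem continuousWithinAt_thrImageDriver_Ici {s : ℝ≥0} (hs : s < β) :
    ContinuousWithinAt (thrImageDriver W A) (Ici s) s := by
  obtain ⟨s', hss', -, hconst⟩ := exists_Icc_remHull_eq hA hfin hs
  set B := remHull W A s with hBdef
  have hB : IsStarHull B := isStarHull_remHull hW hA (hcl s hs.le)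
  have halive : ∀ r ∈ Icc s s', Disjoint (closedHull W r) B := fun r hr ↦ by
    rw [← hconst r hr]; exact disjoint_closedHull_remHull W A le_rfl
  have h1 : ContinuousWithinAt (fun v : ℝ≥0 ↦ imageDriver W B v) (Icc s s') s :=
    (continuousWithinAt_imageDriver' hW hB (halive s ⟨le_rfl, hss'.le⟩)).mono fun r hr ↦ halive r hr
  have h2 : ContinuousWithinAt (fun v : ℝ≥0 ↦ imageDriver W B v + ((starShift A).re - (starShift B).re))
      (Icc s s') s := h1.add continuousWithinAt_const
  have h3 : ContinuousWithinAt (thrImageDriver W A) (Icc s s') s :=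
    h2.congr (fun r hr ↦ thrImageDriver_eq_imageDriver_remHull (hconst r hr))
      (thrImageDriver_eq_imageDriver_remHull rfl)
  exact h3.mono_of_mem_nhdsWithin (Icc_mem_nhdsGE hss')

include hW0 in
/-- **Left-continuity of `U*` at positive times `≤ β`**: on a left piece `[s₀, s)` of constancy with
value `B`, `U*_r = W_r + L_A − L_{g_r(B) − W_r}`; if `B` survives at `s` this is alive continuity, and
at a jump (`T_B = s`, new value `B ∖ K̂_s`) it is (W) `tendsto_starShift_slidHull_hullHitTime`.
[cite: Lawler2005, §6.3 Thm. 6.13 (continuity of U*_t)] -/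
theorem continuousWithinAt_thrImageDriver_Iio {s : ℝ≥0} (hs0 : 0 < s) (hs : s ≤ β) :
    ContinuousWithinAt (thrImageDriver W A) (Iio s) s := by
  obtain ⟨s₀, hs₀, hconst⟩ := exists_Ico_remHull_eq hfin hs0 hs
  set B := remHull W A s₀ with hBdef
  have hB : IsStarHull B := isStarHull_remHull hW hA (hcl s₀ (hs₀.le.trans hs))
  have hrem : remHull W A s = B \ closedHull W s := remHull_eq_remHull_diff W A hs₀.le
  have key : ∀ v : ℝ≥0, (starShift (slidHull W B v)).re = W v + (starShift B).re - imageDriver W B v :=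
    fun v ↦ by rw [imageDriver]; ring
  -- the limit of `L_{g_r(B) − W_r}` as `r ↑ s`
  have hL : Tendsto (fun r : ℝ≥0 ↦ (starShift (slidHull W B r)).re) (𝓝[<] s)
      (𝓝 ((starShift (thrSlidHull W A s)).re)) := by
    by_cases hj : remHull W A s = B
    · -- no jump: `B` is alive at `s`
      have hsal : Disjoint (closedHull W s) B := by
        rw [← hj]; exact disjoint_closedHull_remHull W A le_rfl
      have h1 : ContinuousWithinAt (fun v : ℝ≥0 ↦ imageDriver W B v) (Iio s) s :=
        (continuousWithinAt_imageDriver' hW hB hsal).mono fun r hr ↦ disjoint_closedHull_of_Ico hconst hr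
      have h2 : ContinuousWithinAt (fun v : ℝ≥0 ↦ W v + (starShift B).re - imageDriver W B v) (Iio s) s :=
        ((hW.continuousWithinAt).add continuousWithinAt_const).sub h1
      rw [thrSlidHull, hj, show (fun r : ℝ≥0 ↦ (starShift (slidHull W B r)).re) =
        fun v ↦ W v + (starShift B).re - imageDriver W B v from funext key, key s]
      exact h2.tendsto
    · -- jump: `T_B = s`, (W)
      have hBne : B.Nonempty := by
        rw [nonempty_iff_ne_empty]
        intro hBe
        apply hj
        rw [hrem, hBe, Set.empty_sdiff]
      have hT : hullHitTime W B = s := hullHitTime_remHull_eq hs₀ hconst hj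
      have hclB : IsClosed (B \ closedHull W s) := by rw [← hrem]; exact hcl s hs
      have h := tendsto_starShift_slidHull_hullHitTime hW hW0 hB hBne hT hclB
      rwa [thrSlidHull, hrem]
  have hWt : Tendsto (fun r : ℝ≥0 ↦ W r) (𝓝[<] s) (𝓝 (W s)) :=
    (hW.tendsto s).mono_left nhdsWithin_le_nhds
  have h := (hWt.add (tendsto_const_nhds (x := (starShift A).re))).sub hL
  refine (h.congr' ?_)
  filter_upwards [Ico_mem_nhdsLT hs₀] with r hr
  rw [thrImageDriver, thrSlidHull, hconst r hr]

/-- **`U* = thrImageDriver W A` is continuous on `[0, β]`.** [cite: Lawler2005, §6.3 Thm. 6.13 (continuity of U*_t)] -/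
theorem continuousOn_thrImageDriver (hW0 : W 0 = 0) : ContinuousOn (thrImageDriver W A) (Iic β) :=
  continuousOn_Iic_of_left_right
    (fun _ hs0 hs ↦ continuousWithinAt_thrImageDriver_Iio hW hW0 hA hcl hfin hs0 hs)
    (fun _ hs ↦ continuousWithinAt_thrImageDriver_Ici hW hA hcl hfin hs)

variable {z : ℂ} (hzH : 0 < z.im) (hzA : z ∉ A) (hzβ : (β : WithTop ℝ≥0) < swallowingTime W z)
include hzH hzA hzβ

/-- **Right-continuity of `t ↦ g̃_t(ζ)` before `β`** (alive flow of the fixed remaining hull on a right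
piece). [cite: Lawler2005, §6.3 Thm. 6.13] -/
theorem continuousWithinAt_thrImageFlow_Ici {s : ℝ≥0} (hs : s < β) :
    ContinuousWithinAt (fun t : ℝ≥0 ↦ thrImageFlow W A t z) (Ici s) s := by
  obtain ⟨s', hss', -, hconst⟩ := exists_Icc_remHull_eq hA hfin hs
  set B := remHull W A s with hBdef
  have hB : IsStarHull B := isStarHull_remHull hW hA (hcl s hs.le)
  have halive : ∀ r ∈ Icc s s', Disjoint (closedHull W r) B := fun r hr ↦ by
    rw [← hconst r hr]; exact disjoint_closedHull_remHull W A le_rfl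
  have hzB : z ∉ B := fun h ↦ hzA (remHull_subset W A s h)
  have hzs : (s : WithTop ℝ≥0) < swallowingTime W z := lt_of_le_of_lt (WithTop.coe_le_coe.2 hs.le) hzβ
  have h1 : ContinuousWithinAt (fun v : ℝ≥0 ↦ imageFlow W B v z) (Icc s s') s :=
    (continuousWithinAt_imageFlow' hW hB (halive s ⟨le_rfl, hss'.le⟩) hzH hzB hzs).mono fun r hr ↦ halive r hr
  have h2 : ContinuousWithinAt (fun v : ℝ≥0 ↦ imageFlow W B v z - starShift B + starShift A) (Icc s s') s :=
    (h1.sub continuousWithinAt_const).add continuousWithinAt_const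
  have h3 : ContinuousWithinAt (fun t : ℝ≥0 ↦ thrImageFlow W A t z) (Icc s s') s :=
    h2.congr (fun r hr ↦ thrImageFlow_eq_of_remHull_eq (hconst r hr) z)
      (thrImageFlow_eq_of_remHull_eq rfl z)
  exact h3.mono_of_mem_nhdsWithin (Icc_mem_nhdsGE hss')

/-- **Left-continuity of `t ↦ g̃_t(ζ)` at positive times `≤ β`**: alive continuity if the left value
survives, `tendsto_imageFlow_hullHitTime` at a jump. [cite: Lawler2005, §6.3 Thm. 6.13 (continuity of Φ_t)] -/
theorem continuousWithinAt_thrImageFlow_Iio {s : ℝ≥0} (hs0 : 0 < s) (hs : s ≤ β) :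
    ContinuousWithinAt (fun t : ℝ≥0 ↦ thrImageFlow W A t z) (Iio s) s := by
  obtain ⟨s₀, hs₀, hconst⟩ := exists_Ico_remHull_eq hfin hs0 hs
  set B := remHull W A s₀ with hBdef
  have hB : IsStarHull B := isStarHull_remHull hW hA (hcl s₀ (hs₀.le.trans hs))
  have hrem : remHull W A s = B \ closedHull W s := remHull_eq_remHull_diff W A hs₀.le
  have hzB : z ∉ B := fun h ↦ hzA (remHull_subset W A s₀ h)
  have hzs : (s : WithTop ℝ≥0) < swallowingTime W z := lt_of_le_of_lt (WithTop.coe_le_coe.2 hs) hzβ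
  -- the limit of the alive flow of `B` as `r ↑ s`
  have hF : Tendsto (fun r : ℝ≥0 ↦ imageFlow W B r z - starShift B) (𝓝[<] s)
      (𝓝 (imageFlow W (remHull W A s) s z - starShift (remHull W A s))) := by
    by_cases hj : remHull W A s = B
    · have hsal : Disjoint (closedHull W s) B := by
        rw [← hj]; exact disjoint_closedHull_remHull W A le_rfl
      have h1 : ContinuousWithinAt (fun v : ℝ≥0 ↦ imageFlow W B v z) (Iio s) s :=
        (continuousWithinAt_imageFlow' hW hB hsal hzH hzB hzs).mono fun r hr ↦
          disjoint_closedHull_of_Ico hconst hr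
      rw [hj]
      exact h1.tendsto.sub_const _
    · have hT : hullHitTime W B = s := hullHitTime_remHull_eq hs₀ hconst hj
      have hclB : IsClosed (B \ closedHull W s) := by rw [← hrem]; exact hcl s hs
      rw [hrem]
      exact tendsto_imageFlow_hullHitTime hW hB hT hclB hzH hzB hzs
  have h := hF.add (tendsto_const_nhds (x := starShift A))
  refine h.congr' ?_
  filter_upwards [Ico_mem_nhdsLT hs₀] with r hr
  rw [thrImageFlow_eq_of_remHull_eq (hconst r hr) z]

/-- **`t ↦ g̃_t(ζ) = thrImageFlow W A t z` is continuous on `[0, β]`** for `z ∈ ℍ ∖ A` alive at `β`.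
[cite: Lawler2005, §6.3 Thm. 6.13 (continuity of Φ_t)] -/
theorem continuousOn_thrImageFlow : ContinuousOn (fun t : ℝ≥0 ↦ thrImageFlow W A t z) (Iic β) :=
  continuousOn_Iic_of_left_right
    (fun _ hs0 hs ↦ continuousWithinAt_thrImageFlow_Iio hW hA hcl hfin hzH hzA hzβ hs0 hs)
    (fun _ hs ↦ continuousWithinAt_thrImageFlow_Ici hW hA hcl hfin hzH hzA hzβ hs)

end Continuity

end Loewner

end Literature.Probability.RandomPlanarGeometry

end
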